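/-
Copyright (c) 2026 the pub-hodgecm-mathlib formalisation cell (harness21).  Prover seat hodgecm-mathlib-LH4-p19 (g2), req620 Track A «(D-RAM) FOUR-FRAME» squad
(STAGE-1b, row (2) of the piece `f_{T₊}`, the (β₂) road (R-36) «PURE-CELL LEDGER»; β₂ sub-dealer LH4-p04 (g9) BETA2-BOARD v2 row (ROW-D♭), dealt by name; the lattice
fibration of the diagonal cell), 2026-09-04.
-/
import Summits.HodgeConjecture.HodgeConjecture.Theorems.F0P3cDyRamDiagonalCellCoordinates       -- ★ (this seat, K3): `eq_traceT_mul_hatw`, `map_traceTW`, `traceW_hatw`; brings ★ p862573 `v_inv_add_map_inv_eq`, `v_mul_add_map_mul_eq_one`, `normTheta_sub_map_eq_sq_add`, ★ K2 `hatw_add_map_hatw`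
import Summits.HodgeConjecture.HodgeConjecture.Theorems.F0P3cDyRamDiagonalCellGeneratorChange   -- ★ (this seat, K5a): `v_coords_mul_one_add` (rigidity), `inv_add_eq_inv_mul_one_add`
import Summits.HodgeConjecture.HodgeConjecture.Theorems.F0P3cDyRamConeCellLabelBalance          -- ★ p860765 (LH4-p09): `dualGen_mul_left`, pointwise `ε • Λ`
import HarnessLib

/-!
# Crux `H413`, line LH4 «(D-RAM) FOUR-FRAME» — STAGE-1b, row (2), the (β₂) road (R-36), lane B, row (ROW-D♭), THE COUNT — «THE FIBRES OF THE DIAGONAL CELL OVER THE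
# (class, digit) INVARIANTS ARE EXCHANGED BY FLIPS»: for two literal digits `V₁, V₂` with `ŵ(V₁)∕ŵ(V₂) = e·Θe` (`e` a unit) the flip `Λ ↦ e • Λ` injects the fibre of `D` over
# `(ε, V₁)` into the fibre over `(ε, V₂)` — so all literal fibres of one `T`-class have the same size

Cell `hodgecm-mathlib` (D-0151), FLOOR 0, crux item H413 = `stmt-HodgeConjecture-24833`, route of record `HCCMUnconditional`; squad F0∕P3c∕LH4; lane
`--supports stmt-HodgeConjecture-24833 --as helper` (count-neutral; pays NO tier-0 row).  THEOREMS ONLY (no `def`, no instance, no notation, no `sorry`, default heartbeats);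
★-only imports; states NO law; (β₂) stays a HYPOTHESIS.  DATUM-FREE one-field RamK letters (`M` with `ρ`, `Θ`, `α`, `h`, a pivot `θ₀`; ★ DEFS `IsOrd ∕ dualGen ∕ levelSet`); the
«deep doubly fixed units are `E`-norms» letter `hdeep` (discharged E-side by ★ `exists_mul_map_eq_of_fixed_of_v_sub_one_le_pred` through `jE`) is a binder.

WHY (this seat's ★-cand K3 ∕ K5a; memo MECH-LDflat §2).  The COUNT of (ROW-D♭) (`cellDiff_t(D) = 0` for `2 ≤ δ ≤ 2d − 2`) reads every lattice `Λ = x₀·𝒪_b` of the diagonal cell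
`D = levelSet ρ Θ α ϖE h b b` through `ŵ(x₀) = (ν·h·N_Θ x₀)⁻¹ = T·ŵ(V)` (K3) and needs: the FIBRES of `Λ ↦ (class of T, digit of V)` over the LITERAL digits all have the same
size (then ★ p862655 §3 turns the label balance on digits into the balance on lattices).  THIS FILE proves the fibre exchange at the lattice level: with `e·Θe = ŵ(V₁)∕ŵ(V₂)`,
the generator `e·x₀` of `e • Λ` has `ŵ(e·x₀) = ŵ(x₀)·ŵ(V₂)∕ŵ(V₁) = T·ŵ(V₂)·(1 + (V − V₁)∕(V₁ − ρθ₀))`, so by K5a's RIGIDITY `T′ = T·(1 + O(ϖE^{2d}))` (same `E`-norm class, by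
`hdeep`) and `|V′ − V₂| ≤ |ϖE|^{2d}`; and `e • Λ` stays in `D` (integrality and level from `|Y| = |ϖE^b(α − ρα)|` on the diagonal, Gram-primitivity from `|T′| = 1`).
* §1 `isOrd_mul_of_diag` (`IsOrd(η·Y)` for ANY unit `η` when `|Y| = |cc(α − ρα)|`), `not_isOrd_div_of_trace_unit` (`|κ + ρκ| = 1 ⇒ ¬ IsOrd(Y∕ϖE)`), `v_add_map_eq_one_of_hatw_trace`
  (`|Tr_ρ ŵ′| = 1 ⇒ |κ′ + ρκ′| = 1`, through `ν⁻¹ ≡` a doubly fixed unit).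
* §2 `hatw_mul_gen_eq` (`ŵ(e·x₀) = ŵ(x₀)·(eΘe)⁻¹`), `hatw_div_hatw_eq_one_add` (`ŵ(V)∕ŵ(V₁) = 1 + (V − V₁)∕(V₁ − ρθ₀)`).
* §3 HEAD `ncard_fibre_le_ncard_fibre` ∕ `ncard_fibre_eq_ncard_fibre` — the fibre over `(ε, V₁)` injects into (has the same size as) the fibre over `(ε, V₂)` (the
  five `levelSet` clauses for `e·x₀` are assembled inside the proof; the equality is the injection applied to `e` and to `e⁻¹`).
WHAT IS NOT CLAIMED: the assembly with the digit counts (K6), the E-side discharge of `hdeep`, the bridge to the canonical labels `q±` of the cone ledger.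
HONEST LABEL.  Count-neutral lattice bookkeeping; nothing printed is asserted; no census law is stated; `HC_CM` is proved only modulo the 7 printed citations (2 remaining named
inputs: hLiu418 = `stmt-HodgeConjecture-24832`, h413 = `stmt-HodgeConjecture-24833`) until rung 0 closes.
## References
* [Jacobowitz1962] R. Jacobowitz, *Hermitian forms over local fields*, Amer. J. Math. 84 (1962): §4 (dual lattices, modular components, gluing).
* [Kottwitz1986BaseChangeUnits] R. E. Kottwitz, *Base change for unit elements of Hecke algebras*, Compositio Math. 60 (1986): §1 pp. 240–241 (fixed-lattice counts as orbital integrals).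
* [Flicker1998UnitaryFL] Y. Z. Flicker, *Elementary proof of the fundamental lemma for a unitary group*, Canad. J. Math. 50 (1998): Prop. 7 p. 84 (torus-orbit census, type RamK).
* [Serre1979] J.-P. Serre, *Local Fields*, GTM 67 (1979): Ch. III §6 Prop. 12 (orders), Ch. V §2 Prop. 3, Ch. V §3 Cor. 3 (conductor).
* [Rogawski1990] J. D. Rogawski, *Automorphic Representations of Unitary Groups in Three Variables*, Ann. of Math. Stud. 123 (1990): §4.9 Prop. 4.9.1 (b) p. 55, §12.2.
-/

set_option autoImplicit false

noncomputable section

namespace Summit.HodgeConjecture.HodgeConjecture.Cruxes.H413.F0P3cDyRamDiagonalCellFibreTransport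

open scoped Valued WithZero Pointwise
open WithZero
open Summit.HodgeConjecture.HodgeConjecture.Cruxes.H413.F0P3cDyRamToricCensusDefs
open Summit.HodgeConjecture.HodgeConjecture.Cruxes.H413.F0P3cDyRamDiagonalCellLetter (v_add_map_le_of_le)
open Summit.HodgeConjecture.HodgeConjecture.Cruxes.H413.F0P3cDyRamDiagonalCellScalarUnit (v_inv_add_map_inv_eq v_mul_add_map_mul_eq_one normTheta_sub_map_eq_sq_add
  v_eq_one_of_exp_neg_one_lt)
open Summit.HodgeConjecture.HodgeConjecture.Cruxes.H413.F0P3cDyRamDiagonalCellLiteralDigits (hatw_add_map_hatw)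
open Summit.HodgeConjecture.HodgeConjecture.Cruxes.H413.F0P3cDyRamDiagonalCellCoordinates (eq_traceT_mul_hatw map_traceTW traceW_hatw)
open Summit.HodgeConjecture.HodgeConjecture.Cruxes.H413.F0P3cDyRamDiagonalCellGeneratorChange (v_coords_mul_one_add inv_add_eq_inv_mul_one_add)
open Summit.HodgeConjecture.HodgeConjecture.Cruxes.H413.F0P3cDyRamConeCellLabelBalance (dualGen_mul_left)

variable {K : Type} [Field K] [Valued K ℤᵐ⁰] {ρ Θ : K →+* K} {α : K}

/-! ## §1 Order, primitivity and level clauses for a unit multiple of a diagonal generator -/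

/-- **ON THE DIAGONAL ANY UNIT MULTIPLIER KEEPS THE DUAL GENERATOR IN THE ORDER**: `ρ` isometric, `|η| = 1`, `|Y| ≤ 1`, `|Y − ρY| ≤ |cc(α − ρα)|` and `|Y| ≤ |cc(α − ρα)|`
(the DIAGONAL letter `|Y| = |ϖE^b(α − ρα)|`) ⇒ `IsOrd ρ α cc (η·Y)` (`ηY − ρ(ηY) = η(Y − ρY) + (η − ρη)·ρY`). [cite: Serre1979, Ch. III §6 Prop. 12] [cite: Jacobowitz1962, §4] -/
theorem isOrd_mul_of_diag (hvρ : ∀ x, Valued.v (ρ x) = Valued.v x) {η Y cc : K} (hη1 : Valued.v η = 1) (hY : IsOrd ρ α cc Y)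
    (hYcc : Valued.v Y ≤ Valued.v (cc * (α - ρ α))) : IsOrd ρ α cc (η * Y) := by
  rw [isOrd_iff] at hY ⊢
  refine ⟨by rw [Valuation.map_mul, hη1, one_mul]; exact hY.1, ?_⟩
  have e : η * Y - ρ (η * Y) = η * (Y - ρ Y) + (η - ρ η) * ρ Y := by rw [map_mul]; ring
  rw [e]
  refine (Valuation.map_add _ _ _).trans (max_le ?_ ?_)
  · rw [Valuation.map_mul, hη1, one_mul]; exact hY.2
  · rw [Valuation.map_mul, hvρ]
    calc Valued.v (η - ρ η) * Valued.v Y ≤ 1 * Valued.v Y := by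
          gcongr; exact (Valuation.map_sub _ _ _).trans (max_le hη1.le (by rw [hvρ]; exact hη1.le))
      _ ≤ Valued.v (cc * (α - ρ α)) := by rw [one_mul]; exact hYcc

/-- **A UNIT TRACE MAKES THE DUAL GENERATOR GRAM-PRIMITIVE** (converse of ★ `v_add_map_eq_one_of_not_isOrd_div`): with `ρcc = cc`, `ρϖE = ϖE`, `|ϖE| = exp(−1)`, `cc(α − ρα) ≠ 0`
and `|κ + ρκ| = 1`, the element `κ·cc(α − ρα)∕ϖE` is NOT in the order (`Y∕ϖE − ρ(Y∕ϖE) = (κ + ρκ)·cc(α − ρα)∕ϖE` is too large). [cite: Jacobowitz1962, §4] [cite: Serre1979, Ch. III §6 Prop. 12] -/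
theorem not_isOrd_div_of_trace_unit (hρρ : ∀ x, ρ (ρ x) = x) {cc κ ϖE : K} (hρcc : ρ cc = cc) (hρϖ : ρ ϖE = ϖE) (hcc : cc * (α - ρ α) ≠ 0)
    (hϖE : Valued.v ϖE = exp (-1 : ℤ)) (hκ : Valued.v (κ + ρ κ) = 1) : ¬ IsOrd ρ α cc (κ * (cc * (α - ρ α)) / ϖE) := by
  have hvcc : (0 : ℤᵐ⁰) < Valued.v (cc * (α - ρ α)) := zero_lt_iff.2 ((Valuation.ne_zero_iff _).2 hcc)
  rw [isOrd_iff, not_and_or]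
  refine Or.inr (not_le.2 ?_)
  have hdiff : κ * (cc * (α - ρ α)) / ϖE - ρ (κ * (cc * (α - ρ α)) / ϖE) = (κ + ρ κ) * (cc * (α - ρ α)) / ϖE := by
    rw [map_div₀, map_mul, map_mul, hρcc, map_sub, hρρ, hρϖ]; ring
  have hval : Valued.v ((κ + ρ κ) * (cc * (α - ρ α)) / ϖE) = Valued.v (cc * (α - ρ α)) / exp (-1 : ℤ) := by
    rw [map_div₀, Valuation.map_mul, hκ, one_mul, hϖE]
  rw [hdiff, hval, lt_div_iff₀ exp_pos]
  calc Valued.v (cc * (α - ρ α)) * exp (-1 : ℤ) < Valued.v (cc * (α - ρ α)) * 1 := by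
        gcongr; rw [← exp_zero, exp_lt_exp]; norm_num
    _ = _ := mul_one _

/-- **`|Tr_ρ ŵ| = 1 ⇒ |κ + ρκ| = 1`** for `ŵ = (ν·κ)⁻¹`, `ν = (α − ρα)Θ(α − ρα)`: `ν⁻¹ ≡` a `ρ`-fixed unit modulo `𝔭_M` (RamK case-definer), so ★ `v_mul_add_map_mul_eq_one` transports the unit trace
from `ν·κ` (★ `v_inv_add_map_inv_eq`) to `κ`. [cite: Serre1979, Ch. III §6 Prop. 12] -/
theorem v_add_map_eq_one_of_hatw_trace (hρρ : ∀ x, ρ (ρ x) = x) (hvρ : ∀ x, Valued.v (ρ x) = Valued.v x) (hΘρ : ∀ x, Θ (ρ x) = ρ (Θ x))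
    (hvΘ : ∀ x, Valued.v (Θ x) = Valued.v x) (hαρ1 : Valued.v (α - ρ α) = 1) (hram : Valued.v (α - Θ α) < 1)
    {κ : K} (hκ1 : Valued.v κ = 1) (htr : Valued.v ((((α - ρ α) * Θ (α - ρ α)) * κ)⁻¹ + ρ (((α - ρ α) * Θ (α - ρ α)) * κ)⁻¹) = 1) :
    Valued.v (κ + ρ κ) = 1 := by
  obtain ⟨hρf₁, hf₁, hπ₁⟩ := normTheta_sub_map_eq_sq_add (Θ := Θ) hρρ hvρ hΘρ hαρ1 hram
  set ν : K := (α - ρ α) * Θ (α - ρ α) with hν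
  have hνv : Valued.v ν = 1 := by rw [hν, Valuation.map_mul, hvΘ, hαρ1, mul_one]
  have hν0 : ν ≠ 0 := fun h0 => by rw [h0, map_zero] at hνv; exact zero_ne_one hνv
  have hνκ1 : Valued.v (ν * κ) = 1 := by rw [Valuation.map_mul, hνv, hκ1, mul_one]
  have htr' : Valued.v (ν * κ + ρ (ν * κ)) = 1 := by rw [← v_inv_add_map_inv_eq hvρ hνκ1]; exact htr
  -- `ν⁻¹ = f₁⁻¹·(1 + θ) = f₂ + π₂`
  set f₁ : K := (α - ρ α) * (α - ρ α) with hf₁def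
  set π₁ : K := ν - f₁ with hπ₁def
  have hνsplit : ν = f₁ + π₁ := by rw [hπ₁def]; ring
  have hπ₁v : Valued.v π₁ < 1 := by rw [hπ₁def, hν, hf₁def]; exact hπ₁
  obtain ⟨hinv, hθv, -⟩ := inv_add_eq_inv_mul_one_add (Θ := Θ) hvΘ (n₀ := f₁) (τ := π₁) hf₁ hπ₁v
  have hf₁0 : f₁ ≠ 0 := fun h0 => by rw [h0, map_zero] at hf₁; exact zero_ne_one hf₁
  have e : κ = (f₁⁻¹ + f₁⁻¹ * -(π₁ / (f₁ + π₁))) * (ν * κ) := by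
    have h2 : f₁⁻¹ + f₁⁻¹ * -(π₁ / (f₁ + π₁)) = (f₁ + π₁)⁻¹ := by rw [hinv]; ring
    rw [h2, ← hνsplit, ← mul_assoc, inv_mul_cancel₀ hν0, one_mul]
  rw [e]
  refine v_mul_add_map_mul_eq_one hvρ hνκ1.le htr' (by rw [map_inv₀, hρf₁]) (by rw [map_inv₀, hf₁, inv_one]) ?_
  rw [Valuation.map_mul, map_inv₀, hf₁, inv_one, one_mul, hθv]; exact hπ₁v

/-! ## §2 The `ŵ` of a unit multiple of a generator, and the ratio of two `ŵ(V)` -/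

omit [Valued K ℤᵐ⁰] in
/-- **`ŵ(e·x₀) = ŵ(x₀)·(eΘe)⁻¹`** (`ŵ(x) = (ν·h·xΘx)⁻¹`). [cite: Jacobowitz1962, §4] -/
theorem hatw_mul_gen_eq {ν h e x₀ : K} :
    (ν * (h * (e * x₀ * Θ (e * x₀))))⁻¹ = (ν * (h * (x₀ * Θ x₀)))⁻¹ * (e * Θ e)⁻¹ := by
  rw [map_mul, ← mul_inv]; congr 1; ring

omit [Valued K ℤᵐ⁰] in
/-- **`ŵ(V)∕ŵ(V₁) = 1 + (V − V₁)∕(V₁ − ρθ₀)`** (`V₁ ≠ ρθ₀`). [cite: Serre1979, Ch. V §2 Prop. 3] -/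
theorem hatw_div_hatw_eq_one_add {θ₀ V V₁ : K} (hV₁ : V₁ - ρ θ₀ ≠ 0) (hδ : θ₀ - ρ θ₀ ≠ 0) :
    (V - ρ θ₀) / (θ₀ - ρ θ₀) / ((V₁ - ρ θ₀) / (θ₀ - ρ θ₀)) = 1 + (V - V₁) / (V₁ - ρ θ₀) := by
  field_simp; ring

/-! ## §3 HEAD — the fibre over `(ε, V₁)` injects into the fibre over `(ε, V₂)` under `Λ ↦ e • Λ`, `eΘe = ŵ(V₁)∕ŵ(V₂)` -/

/-- **HEAD — «LITERAL FIBRES OF ONE CLASS HAVE THE SAME SIZE» (injection half).**  One-field RamK letters (`ρ`, `Θ` commuting isometric involutions, `|α − ρα| = 1`, `|α − Θα| < 1`,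
`Θh = h`, a `ρ`-fixed uniformiser `ϖE`, a `Θ`-fixed pivot `θ₀` with `|θ₀| ≤ 1`, `|θ₀ − ρθ₀| = 1`), `1 ≤ b`, `1 ≤ d`, the letter `hdeep` («doubly fixed units `≡ 1 (ϖE^{2d})`
are `Θ`-norms of `ρ`-fixed elements»), two doubly fixed integers `V₁, V₂` and `e` with `eΘe = ŵ(V₁)∕ŵ(V₂)` (a unit), a finite diagonal cell.  FIBRE over `(ε, V₀)` := the lattices
`Λ` with a generator `x₀` satisfying the five `levelSet ρ Θ α ϖE h b b` clauses, whose `T = Tr_ρ ŵ(x₀)` is a `Θ`-norm of a `ρ`-fixed element iff `ε`, and whose ratio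
`V = Tr_ρ(θ₀ŵ)∕Tr_ρ ŵ` has `|V − V₀| ≤ |ϖE|^{2d}`.  THEN `#fibre(ε, V₁) ≤ #fibre(ε, V₂)`. [cite: Kottwitz1986BaseChangeUnits, §1 pp. 240–241] [cite: Flicker1998UnitaryFL, Prop. 7 p. 84]
[cite: Jacobowitz1962, §4] [cite: Serre1979, Ch. V §3 Cor. 3] -/
theorem ncard_fibre_le_ncard_fibre (hρρ : ∀ x, ρ (ρ x) = x) (hvρ : ∀ x, Valued.v (ρ x) = Valued.v x) (hΘΘ : ∀ x, Θ (Θ x) = x)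
    (hΘρ : ∀ x, Θ (ρ x) = ρ (Θ x)) (hvΘ : ∀ x, Valued.v (Θ x) = Valued.v x) (hαρ1 : Valued.v (α - ρ α) = 1) (hram : Valued.v (α - Θ α) < 1)
    {h ϖE θ₀ : K} (hΘh : Θ h = h) (hρϖ : ρ ϖE = ϖE) (hϖE : Valued.v ϖE = exp (-1 : ℤ))
    (hΘθ₀ : Θ θ₀ = θ₀) (hθ1 : Valued.v θ₀ ≤ 1) (hθρ : Valued.v (θ₀ - ρ θ₀) = 1) {b d : ℕ} (hb1 : 1 ≤ b) (hd1 : 1 ≤ d)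
    (hdeep : ∀ u : K, ρ u = u → Θ u = u → Valued.v (u - 1) ≤ Valued.v ϖE ^ (2 * d) → ∃ c : K, ρ c = c ∧ c * Θ c = u)
    {V₁ V₂ : K} (hρV₁ : ρ V₁ = V₁) (hΘV₁ : Θ V₁ = V₁) (hV₁1 : Valued.v V₁ ≤ 1) (hρV₂ : ρ V₂ = V₂) (hΘV₂ : Θ V₂ = V₂) (hV₂1 : Valued.v V₂ ≤ 1)
    {e : K} (he : e * Θ e = (V₁ - ρ θ₀) / (θ₀ - ρ θ₀) / ((V₂ - ρ θ₀) / (θ₀ - ρ θ₀))) (ε : Prop)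
    (hfin : (levelSet ρ Θ α ϖE h b b).Finite) :
    {Λ : AddSubgroup K | ∃ x₀ : K, x₀ ≠ 0 ∧ (∀ x, x ∈ Λ ↔ ∃ ζ, IsOrd ρ α (ϖE ^ b) ζ ∧ x = x₀ * ζ) ∧
        IsOrd ρ α (ϖE ^ b) (dualGen ρ Θ α (ϖE ^ b) h x₀) ∧ ¬ IsOrd ρ α (ϖE ^ b) (dualGen ρ Θ α (ϖE ^ b) h x₀ / ϖE) ∧
        Valued.v (dualGen ρ Θ α (ϖE ^ b) h x₀) = Valued.v ϖE ^ b ∧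
        ((∃ c : K, ρ c = c ∧ c * Θ c = (((α - ρ α) * Θ (α - ρ α)) * (h * (x₀ * Θ x₀)))⁻¹ + ρ (((α - ρ α) * Θ (α - ρ α)) * (h * (x₀ * Θ x₀)))⁻¹) ↔ ε) ∧
        Valued.v ((θ₀ * (((α - ρ α) * Θ (α - ρ α)) * (h * (x₀ * Θ x₀)))⁻¹ + ρ (θ₀ * (((α - ρ α) * Θ (α - ρ α)) * (h * (x₀ * Θ x₀)))⁻¹)) /
            ((((α - ρ α) * Θ (α - ρ α)) * (h * (x₀ * Θ x₀)))⁻¹ + ρ (((α - ρ α) * Θ (α - ρ α)) * (h * (x₀ * Θ x₀)))⁻¹) - V₁) ≤ Valued.v ϖE ^ (2 * d)}.ncard ≤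
      {Λ : AddSubgroup K | ∃ x₀ : K, x₀ ≠ 0 ∧ (∀ x, x ∈ Λ ↔ ∃ ζ, IsOrd ρ α (ϖE ^ b) ζ ∧ x = x₀ * ζ) ∧
        IsOrd ρ α (ϖE ^ b) (dualGen ρ Θ α (ϖE ^ b) h x₀) ∧ ¬ IsOrd ρ α (ϖE ^ b) (dualGen ρ Θ α (ϖE ^ b) h x₀ / ϖE) ∧
        Valued.v (dualGen ρ Θ α (ϖE ^ b) h x₀) = Valued.v ϖE ^ b ∧
        ((∃ c : K, ρ c = c ∧ c * Θ c = (((α - ρ α) * Θ (α - ρ α)) * (h * (x₀ * Θ x₀)))⁻¹ + ρ (((α - ρ α) * Θ (α - ρ α)) * (h * (x₀ * Θ x₀)))⁻¹) ↔ ε) ∧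
        Valued.v ((θ₀ * (((α - ρ α) * Θ (α - ρ α)) * (h * (x₀ * Θ x₀)))⁻¹ + ρ (θ₀ * (((α - ρ α) * Θ (α - ρ α)) * (h * (x₀ * Θ x₀)))⁻¹)) /
            ((((α - ρ α) * Θ (α - ρ α)) * (h * (x₀ * Θ x₀)))⁻¹ + ρ (((α - ρ α) * Θ (α - ρ α)) * (h * (x₀ * Θ x₀)))⁻¹) - V₂) ≤ Valued.v ϖE ^ (2 * d)}.ncard := by
  classical
  -- letters
  have hvϖ0 : Valued.v ϖE ≠ 0 := by rw [hϖE]; exact exp_ne_zero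
  have hϖ0 : ϖE ≠ 0 := fun h0 => by rw [h0, map_zero] at hvϖ0; exact hvϖ0 rfl
  have hϖ1 : Valued.v ϖE ≤ 1 := by rw [hϖE, ← exp_zero, exp_le_exp]; norm_num
  have hϖlt : Valued.v ϖE < 1 := by rw [hϖE, ← exp_zero, exp_lt_exp]; norm_num
  have hr : Valued.v ϖE ^ (2 * d) < 1 := pow_lt_one₀ zero_le hϖlt (by omega)
  have hθ₀ : ρ θ₀ ≠ θ₀ := fun h0 => by rw [h0, sub_self, map_zero] at hθρ; exact zero_ne_one hθρ
  have hδ : θ₀ - ρ θ₀ ≠ 0 := sub_ne_zero.2 (Ne.symm hθ₀)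
  set ν : K := (α - ρ α) * Θ (α - ρ α) with hν
  have hνv : Valued.v ν = 1 := by rw [hν, Valuation.map_mul, hvΘ, hαρ1, mul_one]
  have hν0 : ν ≠ 0 := fun h0 => by rw [h0, map_zero] at hνv; exact zero_ne_one hνv
  have hΘν : Θ ν = ν := by rw [hν, map_mul, hΘΘ, mul_comm]
  have hα0 : α - ρ α ≠ 0 := fun h0 => by rw [h0, map_zero] at hαρ1; exact zero_ne_one hαρ1
  have hcc : ϖE ^ b * (α - ρ α) ≠ 0 := mul_ne_zero (pow_ne_zero _ hϖ0) hα0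
  have hρcc : ρ (ϖE ^ b) = ϖE ^ b := by rw [map_pow, hρϖ]
  have hccv : Valued.v (ϖE ^ b * (α - ρ α)) = Valued.v ϖE ^ b := by rw [Valuation.map_mul, Valuation.map_pow, hαρ1, mul_one]
  -- the two `ŵ(Vᵢ)` are units with trace one
  have hŵunit : ∀ V : K, ρ V = V → Valued.v V ≤ 1 → Valued.v ((V - ρ θ₀) / (θ₀ - ρ θ₀)) = 1 := by
    intro V hρV hV1
    have hle : Valued.v ((V - ρ θ₀) / (θ₀ - ρ θ₀)) ≤ 1 := by
      rw [map_div₀, hθρ, div_one]; exact (Valuation.map_sub _ _ _).trans (max_le hV1 (by rw [hvρ]; exact hθ1))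
    have htr1 := hatw_add_map_hatw (θ₀ := θ₀) hρρ hθ₀ hρV
    by_contra hne
    have hlt : Valued.v ((V - ρ θ₀) / (θ₀ - ρ θ₀)) < 1 := lt_of_le_of_ne hle hne
    have h1 : Valued.v ((V - ρ θ₀) / (θ₀ - ρ θ₀) + ρ ((V - ρ θ₀) / (θ₀ - ρ θ₀))) < 1 :=
      lt_of_le_of_lt (Valuation.map_add _ _ _) (max_lt hlt (by rw [hvρ]; exact hlt))
    rw [htr1, Valuation.map_one] at h1
    exact lt_irrefl _ h1
  have hŵ1 := hŵunit V₁ hρV₁ hV₁1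
  have hŵ2 := hŵunit V₂ hρV₂ hV₂1
  have hŵ10 : (V₁ - ρ θ₀) / (θ₀ - ρ θ₀) ≠ 0 := fun h0 => by rw [h0, map_zero] at hŵ1; exact zero_ne_one hŵ1
  have hŵ20 : (V₂ - ρ θ₀) / (θ₀ - ρ θ₀) ≠ 0 := fun h0 => by rw [h0, map_zero] at hŵ2; exact zero_ne_one hŵ2
  have hV₁θ : V₁ - ρ θ₀ ≠ 0 := fun h0 => hŵ10 (by rw [h0, zero_div])
  have hη1 : Valued.v (e * Θ e) = 1 := by rw [he, map_div₀, hŵ1, hŵ2, div_one]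
  have hη0 : e * Θ e ≠ 0 := fun h0 => by rw [h0, map_zero] at hη1; exact zero_ne_one hη1
  have he0 : e ≠ 0 := fun h0 => hη0 (by rw [h0, zero_mul])
  -- the map and its injectivity
  refine Set.ncard_le_ncard_of_injOn (fun Λ => e • Λ) (fun Λ hΛ => ?_) (fun Λ₁ _ Λ₂ _ h12 => by
      have := congrArg (fun Λ => e⁻¹ • Λ) h12
      simpa only [smul_smul, inv_mul_cancel₀ he0, one_smul] using this)
    (hfin.subset fun Λ ⟨x₀, hx₀, hmem, hyO, hyprim, hylev, _, _⟩ => ⟨x₀, hx₀, hmem, hyO, hyprim, hylev⟩)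
  obtain ⟨x₀, hx₀, hmem, hyO, hyprim, hylev, hcls, hV⟩ := hΛ
  -- names for the old generator
  set κ : K := h * (x₀ * Θ x₀) with hκ
  set ŵ : K := (ν * κ)⁻¹ with hŵdef
  set T : K := ŵ + ρ ŵ with hTdef
  set W : K := θ₀ * ŵ + ρ (θ₀ * ŵ) with hWdef
  have hY : dualGen ρ Θ α (ϖE ^ b) h x₀ = κ * (ϖE ^ b * (α - ρ α)) := by rw [dualGen_def]
  have hκv : Valued.v κ = 1 := by
    have h1 := hylev; rw [hY, Valuation.map_mul, hccv] at h1
    exact (mul_eq_right₀ (pow_ne_zero _ hvϖ0)).1 h1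
  have hκ0 : κ ≠ 0 := fun h0 => by rw [h0, map_zero] at hκv; exact zero_ne_one hκv
  have hΘκ : Θ κ = κ := by rw [hκ, map_mul, map_mul, hΘh, hΘΘ]; ring
  have hΘŵ : Θ ŵ = ŵ := by rw [hŵdef, map_inv₀, map_mul, hΘν, hΘκ]
  have hŵv : Valued.v ŵ = 1 := by rw [hŵdef, map_inv₀, Valuation.map_mul, hνv, hκv, one_mul, inv_one]
  -- Gram-primitivity of `x₀` ⇒ `|T| = 1`
  have hκtr : Valued.v (κ + ρ κ) = 1 := by
    have hY1 : Valued.v (κ * (ϖE ^ b * (α - ρ α)) / ϖE) ≤ 1 := by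
      rw [map_div₀, Valuation.map_mul, hκv, one_mul, hccv, div_le_one₀ (zero_lt_iff.2 hvϖ0)]
      calc Valued.v ϖE ^ b ≤ Valued.v ϖE ^ 1 := pow_le_pow_right_of_le_one' hϖ1 hb1
        _ = _ := pow_one _
    rw [hY] at hyprim
    exact F0P3cDyRamDiagonalCellScalarUnit.v_add_map_eq_one_of_not_isOrd_div hρρ hvρ hρcc hρϖ hcc hκv.le hϖE hY1 hyprim
  have hTv : Valued.v T = 1 := by
    rw [hTdef, hŵdef, v_inv_add_map_inv_eq hvρ (by rw [Valuation.map_mul, hνv, hκv, one_mul])]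
    obtain ⟨hρf₁, hf₁, hπ₁⟩ := normTheta_sub_map_eq_sq_add (Θ := Θ) hρρ hvρ hΘρ hαρ1 hram
    have hsplit : ν = (α - ρ α) * (α - ρ α) + ((α - ρ α) * Θ (α - ρ α) - (α - ρ α) * (α - ρ α)) := by rw [hν]; ring
    rw [hsplit]; exact v_mul_add_map_mul_eq_one hvρ hκv.le hκtr hρf₁ hf₁ hπ₁
  have hT0 : T ≠ 0 := fun h0 => by rw [h0, map_zero] at hTv; exact zero_ne_one hTv
  obtain ⟨hρT, hΘT, hρW, hΘW⟩ := map_traceTW (θ₀ := θ₀) (ŵ := ŵ) hρρ hΘρ hΘθ₀ hΘŵ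
  set V : K := W / T with hVdef
  have hρV : ρ V = V := by rw [hVdef, map_div₀, hρT, hρW]
  have hfact : ŵ = T * ((V - ρ θ₀) / (θ₀ - ρ θ₀)) := by rw [hVdef, hTdef, hWdef]; exact eq_traceT_mul_hatw (ρ := ρ) hθ₀ hT0
  -- the new generator `e·x₀` and its `ŵ′ = T·ŵ(V₂)·(1 + θ)`
  set θ : K := (V - V₁) / (V₁ - ρ θ₀) with hθdef
  have hθv : Valued.v θ ≤ Valued.v ϖE ^ (2 * d) := by
    rw [hθdef, map_div₀]
    have hV₁θv : Valued.v (V₁ - ρ θ₀) = 1 := by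
      have := hŵ1; rw [map_div₀, hθρ, div_one] at this; exact this
    rw [hV₁θv, div_one]; exact hV
  have hŵ' : (ν * (h * (e * x₀ * Θ (e * x₀))))⁻¹ = T * ((V₂ - ρ θ₀) / (θ₀ - ρ θ₀)) * (1 + θ) := by
    rw [hatw_mul_gen_eq, he, ← hκ, ← hŵdef, hfact, hθdef, ← hatw_div_hatw_eq_one_add hV₁θ hδ]
    field_simp
  -- rigidity
  obtain ⟨hT'cls, hT'1, hV'⟩ := v_coords_mul_one_add (ρ := ρ) hvρ (n := T) (w₀ := (V₂ - ρ θ₀) / (θ₀ - ρ θ₀)) (θ := θ) (θ₀ := θ₀) hρT hTv hθ1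
    hŵ2.le (by rw [hatw_add_map_hatw (θ₀ := θ₀) hρρ hθ₀ hρV₂, Valuation.map_one]) hr hθv
  rw [hatw_add_map_hatw (θ₀ := θ₀) hρρ hθ₀ hρV₂, mul_one] at hT'cls
  rw [traceW_hatw (θ₀ := θ₀) hρρ hθ₀ hρV₂, hatw_add_map_hatw (θ₀ := θ₀) hρρ hθ₀ hρV₂, div_one] at hV'
  -- assemble the membership of `e • Λ`
  have hκ' : h * (e * x₀ * Θ (e * x₀)) = (e * Θ e) * κ := by rw [hκ, map_mul]; ring
  refine ⟨e * x₀, mul_ne_zero he0 hx₀, fun x => ?_, ?_, ?_, ?_, ?_, ?_⟩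
  · rw [AddSubgroup.mem_smul_pointwise_iff_exists]
    constructor
    · rintro ⟨s, hs, rfl⟩
      obtain ⟨z, hz, rfl⟩ := (hmem s).1 hs
      exact ⟨z, hz, by rw [smul_eq_mul, mul_assoc]⟩
    · rintro ⟨z, hz, rfl⟩
      exact ⟨x₀ * z, (hmem _).2 ⟨z, hz, rfl⟩, by rw [smul_eq_mul, mul_assoc]⟩
  · rw [dualGen_mul_left]
    exact isOrd_mul_of_diag hvρ hη1 hyO (by rw [hylev, hccv])
  · rw [dualGen_mul_left, hY, ← mul_assoc, mul_div_assoc]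
    have h1 : Valued.v (e * Θ e * κ + ρ (e * Θ e * κ)) = 1 := by
      refine v_add_map_eq_one_of_hatw_trace hρρ hvρ hΘρ hvΘ hαρ1 hram (by rw [Valuation.map_mul, hη1, hκv, one_mul]) ?_
      rw [← hν, ← hκ', hŵ']; exact hT'1
    have := not_isOrd_div_of_trace_unit (α := α) hρρ hρcc hρϖ hcc hϖE h1
    rwa [mul_div_assoc] at this
  · rw [dualGen_mul_left, Valuation.map_mul, hη1, one_mul, hylev]
  · -- the class of `T′`
    rw [hŵ']
    set T' : K := T * ((V₂ - ρ θ₀) / (θ₀ - ρ θ₀)) * (1 + θ) + ρ (T * ((V₂ - ρ θ₀) / (θ₀ - ρ θ₀)) * (1 + θ)) with hT'def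
    have hT'0 : T' ≠ 0 := fun h0 => by rw [h0, map_zero] at hT'1; exact zero_ne_one hT'1
    set uu : K := T' / T with huu
    have hΘe2 : Θ ((V₂ - ρ θ₀) / (θ₀ - ρ θ₀)) = (V₂ - ρ θ₀) / (θ₀ - ρ θ₀) := by rw [map_div₀, map_sub, map_sub, hΘV₂, hΘρ, hΘθ₀]
    have hΘθ : Θ θ = θ := by
      rw [hθdef, map_div₀, map_sub, map_sub, hΘV₁, hΘρ, hΘθ₀, hVdef, map_div₀, hΘW, hΘT]
    have hΘT' : Θ T' = T' := by
      rw [hT'def, map_add, hΘρ, map_mul, map_mul, hΘT, hΘe2, map_add, map_one, hΘθ]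
    have hρT' : ρ T' = T' := by rw [hT'def, map_add, hρρ, add_comm]
    have hρuu : ρ uu = uu := by rw [huu, map_div₀, hρT', hρT]
    have hΘuu : Θ uu = uu := by rw [huu, map_div₀, hΘT', hΘT]
    obtain ⟨c, hρc, hc⟩ := hdeep uu hρuu hΘuu hT'cls
    have hc0 : c ≠ 0 := fun h0 => by
      have : uu = 0 := by rw [← hc, h0, zero_mul]
      rw [huu, div_eq_zero_iff] at this
      rcases this with h | h
      · exact hT'0 h
      · exact hT0 h
    have hTuu : T' = T * uu := by rw [huu, mul_div_cancel₀ _ hT0]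
    rw [← hcls]
    constructor
    · rintro ⟨c', hρc', hc'⟩
      refine ⟨c' / c, by rw [map_div₀, hρc', hρc], ?_⟩
      rw [map_div₀, div_mul_div_comm, hc', hc, hTuu, mul_div_cancel_right₀ _ (by rw [← hc] at *; exact fun h0 => hc0 (by
        rcases mul_eq_zero.1 h0 with h | h
        · exact h
        · exact absurd h ((map_ne_zero Θ).2 hc0)))]
    · rintro ⟨c', hρc', hc'⟩
      exact ⟨c' * c, by rw [map_mul, hρc', hρc], by rw [map_mul, hTuu, ← hc', ← hc]; ring⟩
  · rw [hŵ']
    exact hV'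

/-- **HEAD′ — «LITERAL FIBRES OF ONE CLASS HAVE THE SAME SIZE» (equality).**  Same letters as `ncard_fibre_le_ncard_fibre`; the flip by `e⁻¹` (`e⁻¹Θe⁻¹ = ŵ(V₂)∕ŵ(V₁)`)
injects the other way, so `#fibre(ε, V₁) = #fibre(ε, V₂)`. [cite: Kottwitz1986BaseChangeUnits, §1 pp. 240–241] [cite: Flicker1998UnitaryFL, Prop. 7 p. 84] [cite: Jacobowitz1962, §4] -/
theorem ncard_fibre_eq_ncard_fibre (hρρ : ∀ x, ρ (ρ x) = x) (hvρ : ∀ x, Valued.v (ρ x) = Valued.v x) (hΘΘ : ∀ x, Θ (Θ x) = x)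
    (hΘρ : ∀ x, Θ (ρ x) = ρ (Θ x)) (hvΘ : ∀ x, Valued.v (Θ x) = Valued.v x) (hαρ1 : Valued.v (α - ρ α) = 1) (hram : Valued.v (α - Θ α) < 1)
    {h ϖE θ₀ : K} (hΘh : Θ h = h) (hρϖ : ρ ϖE = ϖE) (hϖE : Valued.v ϖE = exp (-1 : ℤ))
    (hΘθ₀ : Θ θ₀ = θ₀) (hθ1 : Valued.v θ₀ ≤ 1) (hθρ : Valued.v (θ₀ - ρ θ₀) = 1) {b d : ℕ} (hb1 : 1 ≤ b) (hd1 : 1 ≤ d)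
    (hdeep : ∀ u : K, ρ u = u → Θ u = u → Valued.v (u - 1) ≤ Valued.v ϖE ^ (2 * d) → ∃ c : K, ρ c = c ∧ c * Θ c = u)
    {V₁ V₂ : K} (hρV₁ : ρ V₁ = V₁) (hΘV₁ : Θ V₁ = V₁) (hV₁1 : Valued.v V₁ ≤ 1) (hρV₂ : ρ V₂ = V₂) (hΘV₂ : Θ V₂ = V₂) (hV₂1 : Valued.v V₂ ≤ 1)
    {e : K} (he : e * Θ e = (V₁ - ρ θ₀) / (θ₀ - ρ θ₀) / ((V₂ - ρ θ₀) / (θ₀ - ρ θ₀))) (ε : Prop)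
    (hfin : (levelSet ρ Θ α ϖE h b b).Finite) :
    {Λ : AddSubgroup K | ∃ x₀ : K, x₀ ≠ 0 ∧ (∀ x, x ∈ Λ ↔ ∃ ζ, IsOrd ρ α (ϖE ^ b) ζ ∧ x = x₀ * ζ) ∧
        IsOrd ρ α (ϖE ^ b) (dualGen ρ Θ α (ϖE ^ b) h x₀) ∧ ¬ IsOrd ρ α (ϖE ^ b) (dualGen ρ Θ α (ϖE ^ b) h x₀ / ϖE) ∧
        Valued.v (dualGen ρ Θ α (ϖE ^ b) h x₀) = Valued.v ϖE ^ b ∧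
        ((∃ c : K, ρ c = c ∧ c * Θ c = (((α - ρ α) * Θ (α - ρ α)) * (h * (x₀ * Θ x₀)))⁻¹ + ρ (((α - ρ α) * Θ (α - ρ α)) * (h * (x₀ * Θ x₀)))⁻¹) ↔ ε) ∧
        Valued.v ((θ₀ * (((α - ρ α) * Θ (α - ρ α)) * (h * (x₀ * Θ x₀)))⁻¹ + ρ (θ₀ * (((α - ρ α) * Θ (α - ρ α)) * (h * (x₀ * Θ x₀)))⁻¹)) /
            ((((α - ρ α) * Θ (α - ρ α)) * (h * (x₀ * Θ x₀)))⁻¹ + ρ (((α - ρ α) * Θ (α - ρ α)) * (h * (x₀ * Θ x₀)))⁻¹) - V₁) ≤ Valued.v ϖE ^ (2 * d)}.ncard =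
      {Λ : AddSubgroup K | ∃ x₀ : K, x₀ ≠ 0 ∧ (∀ x, x ∈ Λ ↔ ∃ ζ, IsOrd ρ α (ϖE ^ b) ζ ∧ x = x₀ * ζ) ∧
        IsOrd ρ α (ϖE ^ b) (dualGen ρ Θ α (ϖE ^ b) h x₀) ∧ ¬ IsOrd ρ α (ϖE ^ b) (dualGen ρ Θ α (ϖE ^ b) h x₀ / ϖE) ∧
        Valued.v (dualGen ρ Θ α (ϖE ^ b) h x₀) = Valued.v ϖE ^ b ∧
        ((∃ c : K, ρ c = c ∧ c * Θ c = (((α - ρ α) * Θ (α - ρ α)) * (h * (x₀ * Θ x₀)))⁻¹ + ρ (((α - ρ α) * Θ (α - ρ α)) * (h * (x₀ * Θ x₀)))⁻¹) ↔ ε) ∧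
        Valued.v ((θ₀ * (((α - ρ α) * Θ (α - ρ α)) * (h * (x₀ * Θ x₀)))⁻¹ + ρ (θ₀ * (((α - ρ α) * Θ (α - ρ α)) * (h * (x₀ * Θ x₀)))⁻¹)) /
            ((((α - ρ α) * Θ (α - ρ α)) * (h * (x₀ * Θ x₀)))⁻¹ + ρ (((α - ρ α) * Θ (α - ρ α)) * (h * (x₀ * Θ x₀)))⁻¹) - V₂) ≤ Valued.v ϖE ^ (2 * d)}.ncard := by
  refine le_antisymm
    (ncard_fibre_le_ncard_fibre hρρ hvρ hΘΘ hΘρ hvΘ hαρ1 hram hΘh hρϖ hϖE hΘθ₀ hθ1 hθρ hb1 hd1 hdeep hρV₁ hΘV₁ hV₁1 hρV₂ hΘV₂ hV₂1 he ε hfin)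
    (ncard_fibre_le_ncard_fibre hρρ hvρ hΘΘ hΘρ hvΘ hαρ1 hram hΘh hρϖ hϖE hΘθ₀ hθ1 hθρ hb1 hd1 hdeep hρV₂ hΘV₂ hV₂1 hρV₁ hΘV₁ hV₁1 (e := e⁻¹) ?_ ε hfin)
  rw [map_inv₀, ← mul_inv, he, inv_div]

end Summit.HodgeConjecture.HodgeConjecture.Cruxes.H413.F0P3cDyRamDiagonalCellFibreTransport

end
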